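import Summits.ABC.ABC.Theses.IneffectiveSubspace
import Summits.ABC.ABC.Theorems.TowerFourSubLiouville.Negative.DialCalibration

/-!
# `UniformSadicTowerFour` (stmt-ABC-14937): the `S`-loss floor, modulo bounded gaps between primes

Negative-side calibration lemmas of the standing disprover (cycle 1, refuter-cdisprove-stmt-ABC-14937-0,
2026-08-16).  The crux charges a set `S` of at most `K` primes linearly: `c < C·((∏_{p∈S} p)·{M}^S)^(1+ε)`.
Its docstring asserts that the linear loss is forced ("with `(∏ p)^ε` it is false", via primes in short
intervals).  What is actually forced, and by what:

* the factor `∏_{p∈S} p` cannot be DROPPED (`uniformSadicTowerFour_noSFactor_false_of_boundedGaps`) and its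
  exponent cannot be taken in `[0, 1/2)` (`uniformSadicTowerFour_subsqrtSLoss_false_of_boundedGaps`), at
  `K = 2`, GIVEN bounded gaps between primes (Zhang 2014, Maynard 2015, Polymath 8b: `B = 246`; stated as
  an inlined hypothesis since it is not in Mathlib): the point `p + (q − p) = q` with trivial lifts and
  `S = {p, q}` has `S`-free part dividing `q − p ≤ B` (`sfree_dvd`), so the right-hand side is
  `≤ C·((pq)^θ·B)^{1+ε} ≤ C·B^{1+ε}·q^{2θ(1+ε)}`, sublinear in `c = q` once `2θ(1+ε) < 1`;
* primes in `[x, x + x^{0.525}]` (Baker–Harman–Pintz) with the family `(p², q²−p², q²)` force only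
  `θ > 0.2375`; `θ ∈ [1/2, 1)` is forced only heuristically (primes `2^a3^b + 1`, `S = {2,3,p}`), and for a
  FIXED `S` no loss at all is needed under `ABC` — every `S`-loss tightness statement is a statement about
  primes in thin sets, none of which Mathlib has.  Unconditional `S`-loss tightness is therefore not
  claimed here.

All statements inlined (no auxiliary `def`); tool `TowerFourSubLiouville.Negative.key_growth`.
-/

-- `Summit.<Summit>.<Problem>` is the mandated summit-side namespace (CONVENTIONS §2); for the
-- single-conjunct summit `ABC` the two coincide, so the duplicate `ABC.ABC` is deliberate.
set_option linter.dupNamespace false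

namespace Summit.ABC.ABC.Theorems.UniformSadicTowerFour.Negative

open scoped BigOperators
open Summit.ABC.ABC.Theses.IneffectiveSubspace
open Summit.ABC.ABC.Theorems.TowerFourSubLiouville.Negative

/-- **`S`-free parts see only the cofactor.** If every prime factor of `u` lies in `S`, then the
`S`-free part of `u·v` divides `v`. [folklore] -/
theorem sfree_dvd {u v : ℕ} {S : Finset ℕ} (hu0 : u ≠ 0) (hv0 : v ≠ 0) (hu : u.primeFactors ⊆ S) :
    (∏ r ∈ (u * v).primeFactors \ S, r ^ (u * v).factorization r) ∣ v := by
  have h1 : ∀ r ∈ (u * v).primeFactors \ S, (u * v).factorization r = v.factorization r := by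
    intro r hr
    rw [Finset.mem_sdiff] at hr
    have hur : u.factorization r = 0 := by
      apply Nat.factorization_eq_zero_of_not_dvd
      intro hdvd
      exact hr.2 (hu (Nat.mem_primeFactors.mpr ⟨(Nat.mem_primeFactors.mp hr.1).1, hdvd, hu0⟩))
    rw [Nat.factorization_mul hu0 hv0, Finsupp.add_apply, hur, zero_add]
  have h2 : (u * v).primeFactors \ S ⊆ v.primeFactors := by
    intro r hr
    rw [Finset.mem_sdiff] at hr
    have hr' := Nat.mem_primeFactors.mp hr.1
    rcases (Nat.Prime.dvd_mul hr'.1).mp hr'.2.1 with hdu | hdv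
    · exact absurd (hu (Nat.mem_primeFactors.mpr ⟨hr'.1, hdu, hu0⟩)) hr.2
    · exact Nat.mem_primeFactors.mpr ⟨hr'.1, hdv, hv0⟩
  calc (∏ r ∈ (u * v).primeFactors \ S, r ^ (u * v).factorization r)
      = ∏ r ∈ (u * v).primeFactors \ S, r ^ v.factorization r :=
        Finset.prod_congr rfl fun r hr => by rw [h1 r hr]
    _ ∣ ∏ r ∈ v.primeFactors, r ^ v.factorization r := Finset.prod_dvd_prod_of_subset _ _ _ h2
    _ = v := by
        conv_rhs => rw [← Nat.prod_factorization_pow_eq_self hv0,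
          Nat.prod_factorization_eq_prod_primeFactors]

/-- The prime factors of a product of two primes. [folklore] -/
theorem primeFactors_prime_mul_prime {p q : ℕ} (hp : p.Prime) (hq : q.Prime) :
    (p * q).primeFactors ⊆ {p, q} := by
  rw [Nat.primeFactors_mul hp.ne_zero hq.ne_zero, hp.primeFactors, hq.primeFactors]
  intro r hr
  simp only [Finset.mem_union, Finset.mem_singleton] at hr
  simp only [Finset.mem_insert, Finset.mem_singleton]
  exact hr

/-- **The `S`-factor cannot be dropped (at `K = 2`), modulo bounded gaps between primes.**
Hypothesis `H` (inlined): there is `B` such that beyond every `N` there are primes `p < q ≤ p + B`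
(Zhang 2014; Maynard 2015; Polymath 8b, `B = 246` — not in Mathlib).  Then the crux with the factor
`∏_{p∈S} p` deleted from the bracket is false: the point `p + (q − p) = q` (trivial lifts) with
`S = {p, q}` has `S`-free part `∣ q − p ≤ B` (`sfree_dvd`), so `q < C·B²` fails for large `q`.
[cite: ZhangAnnals2014, Thm 1] [cite: MaynardAnnals2015, Thm 1.1] [cite: Polymath8b2014] -/
theorem uniformSadicTowerFour_noSFactor_false_of_boundedGaps
    (hgaps : ∃ B : ℕ, ∀ N : ℕ, ∃ p q : ℕ, N ≤ p ∧ p < q ∧ q ≤ p + B ∧ p.Prime ∧ q.Prime) :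
    ¬ ∀ K : ℕ, ∀ ε : ℝ, 0 < ε → ∃ C : ℝ, 0 < C ∧ ∀ S : Finset ℕ, S.card ≤ K → (∀ p ∈ S, Nat.Prime p) →
      ∀ x y z : Fin 4 → ℕ, (∀ i, 0 < x i ∧ 0 < y i ∧ 0 < z i) →
      (∏ i, x i ^ (i.val + 1)) + (∏ i, y i ^ (i.val + 1)) = ∏ i, z i ^ (i.val + 1) →
      Nat.Coprime (∏ i, x i ^ (i.val + 1)) (∏ i, y i ^ (i.val + 1)) →
      ((∏ i, z i ^ (i.val + 1) : ℕ) : ℝ) < C * ((∏ p ∈ (∏ i, x i * y i * z i).primeFactors \ S,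
        p ^ (∏ i, x i * y i * z i).factorization p : ℕ) : ℝ) ^ (1 + ε) := by
  obtain ⟨B, hB⟩ := hgaps
  intro h
  obtain ⟨C, hC, hK⟩ := h 2 1 one_pos
  obtain ⟨N, hN⟩ := exists_nat_gt (max (B : ℝ) (C * (B : ℝ) ^ 2))
  obtain ⟨p, q, hNp, hpq, hqB, hp, hq⟩ := hB N
  obtain ⟨g, rfl⟩ : ∃ g, q = p + g := ⟨q - p, by omega⟩
  have hg0 : 0 < g := by omega
  have hgB : g ≤ B := by omega
  have hBN : (B : ℝ) < N := lt_of_le_of_lt (le_max_left _ _) hN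
  have hCN : C * (B : ℝ) ^ 2 < N := lt_of_le_of_lt (le_max_right _ _) hN
  have hBp : B < p := by
    have : (B : ℝ) < p := hBN.trans_le (by exact_mod_cast hNp)
    exact_mod_cast this
  have hcop : Nat.Coprime p g :=
    (Nat.Prime.coprime_iff_not_dvd hp).mpr (Nat.not_dvd_of_pos_of_lt hg0 (by omega))
  have hne : p ≠ p + g := by omega
  have key := hK {p, p + g} (by rw [Finset.card_pair hne])
    (by intro r hr
        simp only [Finset.mem_insert, Finset.mem_singleton] at hr
        rcases hr with rfl | rfl
        · exact hp
        · exact hq)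
    ![p, 1, 1, 1] ![g, 1, 1, 1] ![p + g, 1, 1, 1]
    (by intro i; fin_cases i <;> simp [hp.pos, hg0])
    (by simp [Fin.prod_univ_four]) (by simpa [Fin.prod_univ_four] using hcop)
  have h1 : (∏ i : Fin 4, (![p + g, 1, 1, 1] : Fin 4 → ℕ) i ^ (i.val + 1)) = p + g := by
    simp [Fin.prod_univ_four]
  have h2 : (∏ i : Fin 4, (![p, 1, 1, 1] : Fin 4 → ℕ) i * (![g, 1, 1, 1] : Fin 4 → ℕ) i *
      (![p + g, 1, 1, 1] : Fin 4 → ℕ) i) = p * (p + g) * g := by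
    simp [Fin.prod_univ_four]; ring
  rw [h1, h2, show (1 : ℝ) + 1 = 2 by norm_num, Real.rpow_two] at key
  have hdvd := sfree_dvd (S := {p, p + g}) (Nat.mul_ne_zero hp.ne_zero hq.ne_zero) hg0.ne'
    (primeFactors_prime_mul_prime hp hq)
  have hle : ((∏ r ∈ (p * (p + g) * g).primeFactors \ {p, p + g},
      r ^ (p * (p + g) * g).factorization r : ℕ) : ℝ) ≤ B := by
    exact_mod_cast (Nat.le_of_dvd hg0 hdvd).trans hgB
  have hsf0 : (0 : ℝ) ≤ ((∏ r ∈ (p * (p + g) * g).primeFactors \ {p, p + g},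
      r ^ (p * (p + g) * g).factorization r : ℕ) : ℝ) := Nat.cast_nonneg _
  have hq' : (N : ℝ) ≤ ((p + g : ℕ) : ℝ) := by exact_mod_cast hNp.trans (Nat.le_add_right p g)
  have : C * (((∏ r ∈ (p * (p + g) * g).primeFactors \ {p, p + g},
      r ^ (p * (p + g) * g).factorization r : ℕ) : ℝ)) ^ 2 ≤ C * (B : ℝ) ^ 2 := by
    gcongr
  linarith

/-- **The `S`-exponent cannot go below `1/2`, modulo bounded gaps between primes.** With the factor
`∏_{p∈S} p` of the bracket replaced by `(∏_{p∈S} p)^θ`, `0 ≤ θ < 1/2`, the crux is false (at `K = 2`),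
given bounded prime gaps: the same point `p + (q−p) = q`, `S = {p,q}`, has right-hand side
`≤ C·((pq)^θ·B)^{1+ε} ≤ C·B^{1+ε}·q^{2θ(1+ε)}`, and `2θ(1+ε) < 1` for `ε = (1 − 2θ)/2`.
(Baker–Harman–Pintz primes in `[x, x + x^{0.525}]` [cite: BakerHarmanPintz2001] alone give `θ > 0.2375` via `(p², q²−p², q²)`;
`θ ∈ [1/2, 1)` is forced only heuristically, by primes `2^a3^b + 1` with `S = {2,3,p}`.)
[cite: ZhangAnnals2014, Thm 1] [cite: MaynardAnnals2015, Thm 1.1] [cite: Polymath8b2014] -/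
theorem uniformSadicTowerFour_subsqrtSLoss_false_of_boundedGaps
    (hgaps : ∃ B : ℕ, ∀ N : ℕ, ∃ p q : ℕ, N ≤ p ∧ p < q ∧ q ≤ p + B ∧ p.Prime ∧ q.Prime)
    (θ : ℝ) (hθ0 : 0 ≤ θ) (hθ : θ < 1 / 2) :
    ¬ ∀ K : ℕ, ∀ ε : ℝ, 0 < ε → ∃ C : ℝ, 0 < C ∧ ∀ S : Finset ℕ, S.card ≤ K → (∀ p ∈ S, Nat.Prime p) →
      ∀ x y z : Fin 4 → ℕ, (∀ i, 0 < x i ∧ 0 < y i ∧ 0 < z i) →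
      (∏ i, x i ^ (i.val + 1)) + (∏ i, y i ^ (i.val + 1)) = ∏ i, z i ^ (i.val + 1) →
      Nat.Coprime (∏ i, x i ^ (i.val + 1)) (∏ i, y i ^ (i.val + 1)) →
      ((∏ i, z i ^ (i.val + 1) : ℕ) : ℝ) < C * ((∏ p ∈ S, (p : ℝ)) ^ θ *
        ((∏ p ∈ (∏ i, x i * y i * z i).primeFactors \ S,
          p ^ (∏ i, x i * y i * z i).factorization p : ℕ) : ℝ)) ^ (1 + ε) := by
  obtain ⟨B, hB⟩ := hgaps
  intro h
  set ε : ℝ := (1 - 2 * θ) / 2 with hε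
  have hε0 : 0 < ε := by rw [hε]; linarith
  set s : ℝ := 2 * θ * (1 + ε) with hs
  have hs1 : s < 1 := by
    rw [hs, hε]; nlinarith
  obtain ⟨C, hC, hK⟩ := h 2 ε hε0
  obtain ⟨M, hM1, hM⟩ := key_growth (K := C * (B : ℝ) ^ (1 + ε)) (by positivity) hs1
  obtain ⟨N, hN⟩ := exists_nat_gt (max (B : ℝ) M)
  obtain ⟨p, q, hNp, hpq, hqB, hp, hq⟩ := hB N
  obtain ⟨g, rfl⟩ : ∃ g, q = p + g := ⟨q - p, by omega⟩
  have hg0 : 0 < g := by omega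
  have hgB : g ≤ B := by omega
  have hBN : (B : ℝ) < N := lt_of_le_of_lt (le_max_left _ _) hN
  have hMN : M < N := lt_of_le_of_lt (le_max_right _ _) hN
  have hBp : B < p := by
    have : (B : ℝ) < p := hBN.trans_le (by exact_mod_cast hNp)
    exact_mod_cast this
  have hcop : Nat.Coprime p g :=
    (Nat.Prime.coprime_iff_not_dvd hp).mpr (Nat.not_dvd_of_pos_of_lt hg0 (by omega))
  have hne : p ≠ p + g := by omega
  have key := hK {p, p + g} (by rw [Finset.card_pair hne])
    (by intro r hr
        simp only [Finset.mem_insert, Finset.mem_singleton] at hr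
        rcases hr with rfl | rfl
        · exact hp
        · exact hq)
    ![p, 1, 1, 1] ![g, 1, 1, 1] ![p + g, 1, 1, 1]
    (by intro i; fin_cases i <;> simp [hp.pos, hg0])
    (by simp [Fin.prod_univ_four]) (by simpa [Fin.prod_univ_four] using hcop)
  have h1 : (∏ i : Fin 4, (![p + g, 1, 1, 1] : Fin 4 → ℕ) i ^ (i.val + 1)) = p + g := by
    simp [Fin.prod_univ_four]
  have h2 : (∏ i : Fin 4, (![p, 1, 1, 1] : Fin 4 → ℕ) i * (![g, 1, 1, 1] : Fin 4 → ℕ) i *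
      (![p + g, 1, 1, 1] : Fin 4 → ℕ) i) = p * (p + g) * g := by
    simp [Fin.prod_univ_four]; ring
  rw [h1, h2, Finset.prod_pair hne] at key
  -- the S-free part is at most B
  have hdvd := sfree_dvd (S := {p, p + g}) (Nat.mul_ne_zero hp.ne_zero hq.ne_zero) hg0.ne'
    (primeFactors_prime_mul_prime hp hq)
  have hle : ((∏ r ∈ (p * (p + g) * g).primeFactors \ {p, p + g},
      r ^ (p * (p + g) * g).factorization r : ℕ) : ℝ) ≤ B := by
    exact_mod_cast (Nat.le_of_dvd hg0 hdvd).trans hgB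
  set F : ℝ := ((∏ r ∈ (p * (p + g) * g).primeFactors \ {p, p + g},
      r ^ (p * (p + g) * g).factorization r : ℕ) : ℝ) with hF
  have hF0 : 0 ≤ F := Nat.cast_nonneg _
  -- abbreviate T = q
  set T : ℝ := ((p + g : ℕ) : ℝ) with hT
  have hT1 : (1 : ℝ) ≤ T := by
    have h2p : 1 ≤ p + g := by have := hp.two_le; omega
    rw [hT]; exact_mod_cast h2p
  have hT0 : 0 < T := by linarith
  have hpT : (p : ℝ) ≤ T := by rw [hT]; exact_mod_cast Nat.le_add_right p g
  have hMT : M ≤ T := by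
    rw [hT]; exact hMN.le.trans (by exact_mod_cast hNp.trans (Nat.le_add_right p g))
  -- bound the bracket: (p*T)^θ * F ≤ T^(2θ) * B
  have hbase : ((p : ℝ) * T) ^ θ * F ≤ T ^ (2 * θ) * B := by
    have h1' : ((p : ℝ) * T) ^ θ ≤ (T * T) ^ θ :=
      Real.rpow_le_rpow (by positivity) (mul_le_mul_of_nonneg_right hpT hT0.le) hθ0
    have h2' : (T * T) ^ θ = T ^ (2 * θ) := by
      rw [show T * T = T ^ (2:ℝ) by rw [Real.rpow_two]; ring, ← Real.rpow_mul hT0.le]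
    rw [← h2']
    exact mul_le_mul h1' hle hF0 (Real.rpow_nonneg (by positivity) _)
  have hbase0 : 0 ≤ ((p : ℝ) * T) ^ θ * F := mul_nonneg (Real.rpow_nonneg (by positivity) _) hF0
  have hrhs : C * (((p : ℝ) * T) ^ θ * F) ^ (1 + ε) ≤ C * (B : ℝ) ^ (1 + ε) * T ^ s := by
    have h3 : (((p : ℝ) * T) ^ θ * F) ^ (1 + ε) ≤ (T ^ (2 * θ) * B) ^ (1 + ε) :=
      Real.rpow_le_rpow hbase0 hbase (by linarith)
    have h4 : (T ^ (2 * θ) * (B : ℝ)) ^ (1 + ε) = (B : ℝ) ^ (1 + ε) * T ^ s := by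
      rw [Real.mul_rpow (Real.rpow_nonneg hT0.le _) (Nat.cast_nonneg B), ← Real.rpow_mul hT0.le, hs]
      ring_nf
    calc C * (((p : ℝ) * T) ^ θ * F) ^ (1 + ε) ≤ C * (T ^ (2 * θ) * B) ^ (1 + ε) :=
          mul_le_mul_of_nonneg_left h3 hC.le
      _ = C * (B : ℝ) ^ (1 + ε) * T ^ s := by rw [h4]; ring
  have hgrow := hM T hMT
  -- key : T < C * ((p * T) ^ θ * F) ^ (1 + ε)
  have hkey : T < C * (((p : ℝ) * T) ^ θ * F) ^ (1 + ε) := by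
    have := key
    simpa [hT, hF, Nat.cast_add] using this
  linarith

end Summit.ABC.ABC.Theorems.UniformSadicTowerFour.Negative
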